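import Literature.NumberTheory.EllipticCurves.ZpExtensionEisensteinTowerDivisionProofs
import Literature.NumberTheory.EllipticCurves.ZpExtensionEisensteinSelmerStructure
import Literature.NumberTheory.EllipticCurves.ZpExtensionEisensteinOrdinaryFiltration
import Literature.NumberTheory.EllipticCurves.TorsionFilAtCyclicOrdinaryProofs
import Literature.NumberTheory.EllipticCurves.NeronOggShafarevichLocal
import HarnessLib

/-!
# The two-index family of the Eisenstein tower preserves the twisted plus parts (theorems only)

`Proofs` file (theorems only; no definition, no named fact, no instance, no `sorry`).  Topic `NumberTheory/EllipticCurves`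
(cell `pub/bsd-print-x9`, memo `HOME/x9-p1-w3/H5B-AT-P-PLAN-w3g5.md`, file V2: the module input `hFf` of
`Tower.map_levelCondition_one_eq_strictSubgroup` (V1, `TowerStrictCorePropagationProofs`) for Howard's `F_𝔮` at `v ∣ p`).

For a tower `(M_k, t_k)` with an ordinary filtration `Φ` (`ZpExtension.OrdinaryFiltration`: `Fil_v M_k`, `Γ_{K_v}`-stable,
`t_k(Fil_v M_{k+1}) ⊆ Fil_v M_k`) the two-index family `F a b = ZpExtension.eisensteinTwistTransfer` of the Eisenstein tower
`W_k = M_k ⊗ A_{m,k}(ψ)` carries the twisted plus part `Fil_v W_a = A_{m,a} ⊗ Fil_v M_a` (`Φ.twistedFil a`) into `Fil_v W_b`: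
* §1 downwards (`b ≤ a`, the reductions) unconditionally (`eisensteinTwistTransfer_mem_twistedFil_of_le`);
* §2 upwards (`a ≤ b`, the divisions `×p^{b−a}`) as soon as the transitions are ONTO on the plus parts
  (`hFsurj : t_k(Fil_v M_{k+1}) = Fil_v M_k`): **`eisensteinTwistTransfer_mem_twistedFil`**;
* §3 for the curve: `×p : Fil_v E[p^{k+1}] → Fil_v E[p^k]` is onto at a place `v ∋ p` of good reduction with an ordinary point
  (`E₁(K̄_v)` is `p`-divisible, `exists_nsmul_eq_of_mem_localKernelOfReduction`; torsion of `E(K̄_v)` is algebraic,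
  `exists_pointsMapOfEmb_eq_of_nsmul_eq_zero`) — **`WeierstrassCurve.exists_mem_torsionFilAt_reduce_eq`** — whence
  **`WeierstrassCurve.eisensteinTwistTransfer_mem_twistedFil_ordinaryFiltrationAt`**.
No summit statement is proved; BSD is not proved by any of this.  Seat `bsd-line-x9-p1-w3` g5.

References: [Howard2004HeegnerKolyvagin] Def. 1.1.3, §3.1 (arXiv:1202.6340 p. 15, L56–62: `Fil_v T_𝔮 = Fil_v T ⊗ S_𝔮`),
Def. 3.2.5; [GreenbergLNM1716] §1 p. 62, §2 p. 82; [SilvermanAEC2009] Cor. III.6.4, VII.2.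
-/

set_option autoImplicit false

noncomputable section

open scoped TensorProduct ContRepresentation
open Function Field

namespace Literature.NumberTheory.EllipticCurves.ZpExtension

open Literature.NumberTheory.GaloisRepresentations IwasawaAlgebra
open IsDedekindDomain
open scoped NumberField

variable {K : Type} [Field K] [NumberField K] {p : ℕ} [hp : Fact p.Prime] (κ : ZpExtension K p)
  {M : ℕ → Type} [∀ k, AddCommGroup (M k)] [∀ k, TopologicalSpace (M k)] [∀ k, DiscreteTopology (M k)]
  (ρ : ∀ k, DiscreteGaloisModule K (M k))
  (t : ∀ k, (ρ (k + 1)).toContRepresentation →ⁱL (ρ k).toContRepresentation)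
  {m : ℕ} (hm : 1 ≤ m) (ht : ∀ k, Function.Surjective (t k))
  (hkt : ∀ k (x : M (k + 1)), t k x = 0 ↔ ∃ y : M (k + 1), x = ((p : ℤ) ^ k) • y)
  (hkill : ∀ k (x : M k), ((p : ℤ) ^ k) • x = 0)
  {v : HeightOneSpectrum (𝓞 K)} (Φ : OrdinaryFiltration ρ t v)

/-! ## §1 The reductions preserve the twisted plus parts -/

/-- One step: `red_{k+1→k} = (c ⊗ a ↦ c̄ ⊗ t a)` carries `Fil_v W_{k+1}` into `Fil_v W_k`.
[cite: Howard2004HeegnerKolyvagin, §3.1 (arXiv p. 15, L56–62)] -/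
theorem eisensteinTwistReduce_mem_twistedFil (k : ℕ) {x : EisensteinCoeff.Twisted p m (k + 1) (M (k + 1))}
    (hx : x ∈ Φ.twistedFil (p := p) (m := m) (k + 1)) :
    κ.eisensteinTwistReduce hm (Nat.le_succ k) (t k) x ∈ Φ.twistedFil (p := p) (m := m) k := by
  induction hx using Submodule.span_induction with
  | mem y hy =>
    obtain ⟨c, a, ha, rfl⟩ := hy
    rw [eisensteinTwistReduce_tmul]
    exact Φ.tmul_mem_twistedFil k _ (Φ.map_mem k a ha)
  | zero => rw [map_zero]; exact Submodule.zero_mem _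
  | add y z _ _ hy hz => rw [map_add]; exact Submodule.add_mem _ hy hz
  | smul n y _ hy => rw [map_zsmul]; exact Submodule.smul_mem _ n hy

/-- **The reductions `F a b` (`b ≤ a`) carry `Fil_v W_a` into `Fil_v W_b`.** [cite: Howard2004HeegnerKolyvagin, §3.1 (arXiv p. 15, L56–62)] -/
theorem eisensteinTwistTransfer_mem_twistedFil_of_le {a b : ℕ} (hba : b ≤ a)
    {x : EisensteinCoeff.Twisted p m a (M a)} (hx : x ∈ Φ.twistedFil (p := p) (m := m) a) :
    κ.eisensteinTwistTransfer ρ t hm ht hkt hkill a b x ∈ Φ.twistedFil (p := p) (m := m) b := by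
  obtain ⟨e, rfl⟩ := Nat.exists_eq_add_of_le hba
  induction e with
  | zero =>
    have h0 : κ.eisensteinTwistTransfer ρ t hm ht hkt hkill (b + 0) b x = x :=
      κ.eisensteinTwistTransfer_self ρ t hm ht hkt hkill b x
    rw [h0]
    exact hx
  | succ e ih =>
    have hstep : κ.eisensteinTwistTransfer ρ t hm ht hkt hkill (b + e + 1) (b + e) x ∈
        Φ.twistedFil (p := p) (m := m) (b + e) := by
      rw [κ.eisensteinTwistTransfer_succ_self ρ t hm ht hkt hkill (b + e)]
      exact κ.eisensteinTwistReduce_mem_twistedFil ρ t hm Φ (b + e) hx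
    have h := ih (Nat.le_add_right b e) hstep
    have hcomp : κ.eisensteinTwistTransfer ρ t hm ht hkt hkill (b + e) b
        (κ.eisensteinTwistTransfer ρ t hm ht hkt hkill (b + e + 1) (b + e) x) =
        κ.eisensteinTwistTransfer ρ t hm ht hkt hkill (b + e + 1) b x :=
      κ.eisensteinTwistTransfer_comp ρ t hm ht hkt hkill (Nat.le_add_right b e) (Nat.le_succ _) x
    rw [hcomp] at h
    exact h

/-! ## §2 The divisions preserve the twisted plus parts when the transitions are onto on the plus parts -/

/-- Iterating `hFsurj`: every `y ∈ Fil_v M_a` is `t^{b−a} y'` for some `y' ∈ Fil_v M_b` (`a ≤ b`).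
[cite: GreenbergLNM1716, §2 p. 82 («𝓕(𝔪̄) is divisible»)] -/
theorem exists_mem_fil_transitionIter_eq (hFsurj : ∀ (k : ℕ) (y : M k), y ∈ Φ.fil k → ∃ y' ∈ Φ.fil (k + 1), t k y' = y)
    {a b : ℕ} (hab : a ≤ b) (y : M a) (hy : y ∈ Φ.fil a) :
    ∃ y' ∈ Φ.fil b, transitionIter ρ t hab y' = y := by
  obtain ⟨e, rfl⟩ := Nat.exists_eq_add_of_le hab
  induction e with
  | zero => exact ⟨y, hy, transitionIter_self ρ t a y⟩
  | succ e ih =>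
    obtain ⟨y₁, hy₁, h₁⟩ := ih (Nat.le_add_right a e)
    obtain ⟨y₂, hy₂, h₂⟩ := hFsurj (a + e) y₁ hy₁
    refine ⟨y₂, hy₂, ?_⟩
    have hs : transitionIter ρ t hab y₂ = transitionIter ρ t (Nat.le_add_right a e) (t (a + e) y₂) :=
      transitionIter_succ ρ t (Nat.le_add_right a e) y₂
    rw [hs, h₂, h₁]

/-- **The whole two-index family preserves the twisted plus parts** when the transitions are onto on the plus parts:
for `a ≤ b`, `F a b (c ⊗ y) = p^{b−a} • (c' ⊗ y')` with `c̄' = c`, `t^{b−a} y' = y`, `y' ∈ Fil_v M_b`.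
[cite: Howard2004HeegnerKolyvagin, Def. 1.1.3 and §3.1 (arXiv p. 15, L56–62)] [cite: GreenbergLNM1716, §2 p. 82] -/
theorem eisensteinTwistTransfer_mem_twistedFil
    (hFsurj : ∀ (k : ℕ) (y : M k), y ∈ Φ.fil k → ∃ y' ∈ Φ.fil (k + 1), t k y' = y) (a b : ℕ)
    (x : EisensteinCoeff.Twisted p m a (M a)) (hx : x ∈ Φ.twistedFil (p := p) (m := m) a) :
    κ.eisensteinTwistTransfer ρ t hm ht hkt hkill a b x ∈ Φ.twistedFil (p := p) (m := m) b := by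
  by_cases hba : b ≤ a
  · exact κ.eisensteinTwistTransfer_mem_twistedFil_of_le ρ t hm ht hkt hkill Φ hba hx
  have hab : a ≤ b := le_of_not_ge hba
  induction hx using Submodule.span_induction with
  | mem y hy =>
    obtain ⟨c, y, hy, rfl⟩ := hy
    obtain ⟨y', hy', hyy⟩ := exists_mem_fil_transitionIter_eq ρ t Φ hFsurj hab y hy
    obtain ⟨c', rfl⟩ := EisensteinCoeff.reduce_surjective (p := p) m hab c
    have hred : κ.eisensteinTwistTransfer ρ t hm ht hkt hkill b a (EisensteinCoeff.Twisted.tmul c' y') =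
        EisensteinCoeff.Twisted.tmul (EisensteinCoeff.reduce p m hab c') y := by
      rw [κ.eisensteinTwistTransfer_of_le ρ t hm ht hkt hkill hab]
      change κ.eisensteinTwistReduce hm hab (transitionIter ρ t hab) _ = _
      rw [eisensteinTwistReduce_tmul, hyy]
    rw [← hred, κ.eisensteinTwistTransfer_apply_apply ρ t hm ht hkt hkill hab]
    exact Submodule.smul_of_tower_mem _ (p ^ (b - a)) (Φ.tmul_mem_twistedFil b c' hy')
  | zero => rw [map_zero]; exact Submodule.zero_mem _
  | add y z _ _ hy hz => rw [map_add]; exact Submodule.add_mem _ hy hz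
  | smul n y _ hy => rw [map_zsmul]; exact Submodule.smul_mem _ n hy

end Literature.NumberTheory.EllipticCurves.ZpExtension

/-! ## §3 The curve: `×p : Fil_v E[p^{k+1}] ↠ Fil_v E[p^k]` -/

namespace WeierstrassCurve

open Literature.NumberTheory.EllipticCurves Literature.NumberTheory.GaloisRepresentations
open Literature.NumberTheory.EllipticCurves.IwasawaAlgebra
open IsDedekindDomain
open scoped NumberField

variable {K : Type} [Field K] [NumberField K] (W : WeierstrassCurve K) [W.IsElliptic] {p : ℕ} [hp : Fact p.Prime]
  (v : HeightOneSpectrum (𝓞 K))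

/-- **`×p : Fil_v E[p^{k+1}] → Fil_v E[p^k]` is onto** at a place `v ∋ p` of good reduction with an ordinary point:
`E₁(K̄_v)` is `p`-divisible and the torsion of `E(K̄_v)` comes from `E(K̄)`.
[cite: GreenbergLNM1716, §2 p. 82 («since 𝓕(𝔪̄) is divisible»)] [cite: SilvermanAEC2009, Cor. III.6.4 and VII.2] -/
theorem exists_mem_torsionFilAt_reduce_eq (hgood : W.HasGoodReductionAt v) (hpv : (p : 𝓞 K) ∈ v.asIdeal)
    (hord : ∃ P : localPoints W (v.adicCompletion K), (p : ℤ) • P = 0 ∧ P ∉ W.localKernelOfReduction v)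
    (t : ∀ k, (W.torsionGaloisModule ((p : ℤ) ^ (k + 1))).toContRepresentation →ⁱL
      (W.torsionGaloisModule ((p : ℤ) ^ k)).toContRepresentation)
    (ht : ∀ k (P : geomTorsion W ((p : ℤ) ^ (k + 1))), t k P = W.geomTorsionReduce p k P)
    (k : ℕ) (y : geomTorsion W ((p : ℤ) ^ k)) (hy : y ∈ W.torsionFilAt v ((p : ℤ) ^ k)) :
    ∃ y' ∈ W.torsionFilAt v ((p : ℤ) ^ (k + 1)), t k y' = y := by
  obtain ⟨b, hb, hpb⟩ := W.exists_nsmul_eq_of_mem_localKernelOfReduction v hgood hpv hord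
    ((W.mem_torsionFilAt_iff v _ y).mp hy)
  -- `b` is `p^{k+1}`-torsion, hence algebraic
  have hy0 : ((p : ℤ) ^ k) • (y : geomPoints W) = 0 := (mem_geomTorsion_iff W _ _).mp y.2
  have hbtor : (p ^ (k + 1)) • b = 0 := by
    rw [pow_succ, mul_nsmul', hpb, ← map_nsmul, ← natCast_zsmul, Nat.cast_pow, hy0, map_zero]
  obtain ⟨P, hP, hPb⟩ := exists_pointsMapOfEmb_eq_of_nsmul_eq_zero W (closureEmb (K := K) (v.adicCompletion K))
    (pow_ne_zero (k + 1) hp.out.ne_zero) hbtor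
  have hPmem : P ∈ geomTorsion W ((p : ℤ) ^ (k + 1)) := by
    rw [mem_geomTorsion_iff, ← Nat.cast_pow, natCast_zsmul]; exact hP
  refine ⟨⟨P, hPmem⟩, (W.mem_torsionFilAt_iff v _ _).mpr (by rw [hPb]; exact hb), ?_⟩
  rw [ht]
  apply Subtype.ext
  rw [W.coe_geomTorsionReduce]
  apply pointsMapOfEmb_injective W (closureEmb (K := K) (v.adicCompletion K))
  change pointsMapOfEmb W (closureEmb (K := K) (v.adicCompletion K)) ((p : ℤ) • P) =
    pointsMapOfEmb W (closureEmb (K := K) (v.adicCompletion K)) (y : geomPoints W)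
  rw [map_zsmul, hPb, ← hpb, natCast_zsmul]

/-- **The two-index family of the curve's Eisenstein tower preserves the twisted plus parts `A_{m,k} ⊗ Fil_v E[p^k]`**
at a place `v ∋ p` of good reduction with an ordinary point (both the reductions and the divisions `×p^{b−a}`): the
hypothesis `hFf` of `Tower.map_levelCondition_one_eq_strictSubgroup` for Howard's `F_𝔮` at `v ∣ p`.
[cite: Howard2004HeegnerKolyvagin, Def. 1.1.3 and §3.1 (arXiv p. 15, L56–62)] [cite: GreenbergLNM1716, §2 p. 82] -/
theorem eisensteinTwistTransfer_mem_twistedFil_ordinaryFiltrationAt (κ : ZpExtension K p) {m : ℕ} (hm : 1 ≤ m)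
    (hgood : W.HasGoodReductionAt v) (hpv : (p : 𝓞 K) ∈ v.asIdeal)
    (hord : ∃ P : localPoints W (v.adicCompletion K), (p : ℤ) • P = 0 ∧ P ∉ W.localKernelOfReduction v)
    (t : ∀ k, (W.torsionGaloisModule ((p : ℤ) ^ (k + 1))).toContRepresentation →ⁱL
      (W.torsionGaloisModule ((p : ℤ) ^ k)).toContRepresentation)
    (ht : ∀ k (P : geomTorsion W ((p : ℤ) ^ (k + 1))), t k P = W.geomTorsionReduce p k P)
    (a b : ℕ) (x : EisensteinCoeff.Twisted p m a (geomTorsion W ((p : ℤ) ^ a)))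
    (hx : x ∈ (W.ordinaryFiltrationAt v t ht).twistedFil (p := p) (m := m) a) :
    κ.eisensteinTwistTransfer (fun k ↦ W.torsionGaloisModule ((p : ℤ) ^ k)) t hm
        (W.torsionGaloisModule_transition_hypotheses t (fun k P ↦ by rw [ht]; rfl)).1
        (W.torsionGaloisModule_transition_hypotheses t (fun k P ↦ by rw [ht]; rfl)).2.1
        (W.torsionGaloisModule_transition_hypotheses t (fun k P ↦ by rw [ht]; rfl)).2.2
        a b x ∈
      (W.ordinaryFiltrationAt v t ht).twistedFil (p := p) (m := m) b :=
  κ.eisensteinTwistTransfer_mem_twistedFil _ _ hm _ _ _ _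
    (fun k y hy ↦ W.exists_mem_torsionFilAt_reduce_eq v hgood hpv hord t ht k y hy) a b x hx

end WeierstrassCurve

end
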